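import Summits.QuantumFields.YangMills.Theorems.BalabanUVNodesN08HaarCompatibilityGuardChartLift
import Summits.QuantumFields.YangMills.Theorems.BalabanUVNodesN08HaarCompatibilityGuardJacobianContractionFrame
import Mathlib.Algebra.QuadraticDiscriminant

/-!
# BalabanUVNodes ∕ N08 — THE DEFECT OPERATOR OF THE PRINTED exp-mean-log FIBRE MAP IS SYMMETRIC POSITIVE SEMI-DEFINITE
# (item 3, part 30A: the algebra behind the monotone height)

WIDTH SEAT `pub-ymgap-dag-n08-w3` g6, item-3 lineage (successor of g5's parts 26A–29C; g5 HANDOFF «What is left (i) RANGE»), 2026-08-28.  DAG node N08 =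
[Balaban1985UV3] Thm 1 p. 257 (compact) + Thm 2 p. 272; the typed (0.4) averaging and its guard = [Balaban1987RG1] (0.4) p. 253; key item K1⁷
`StabilityBAtRecordR13SepCoPH` (stmt-QuantumFields-20542, `aside`), `--supports … --as helper`.  COUNT-NEUTRAL.

THE POINT.  Part 26B (p624810) proved GLOBAL injectivity of the quaternion fibre map `k(u) = exp(Σᵢcᵢ qlog(aᵢū))·u` on its guard set under the smallness
`(Σcᵢ)θ² < sin²θ` (`Σcᵢ ≤ 24∕25` at the typed guard) by a contraction argument that sees only OPERATOR NORMS (`‖N_Z‖ = θ∕sin θ > 1`).  The finer structure: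
along a guarded geodesic with right-trivialised direction `X`, the tangent is `k′(w)(w x) = D exp(Y)(P X)·w` (part 27A `kD_apply_mul`), `P X = N_Y X − Σcᵢ N_{Zᵢ} X`,
and
  ★ `N_sub_sum_N_eq`: **`P X = (1 − Σcᵢ)·X + B X`, `B X = Σᵢ cᵢψ(‖Zᵢ‖)·perp_{Zᵢ} X − ψ(‖Y‖)·perp_Y X`** — the skew parts `Zᵢ·perp_{Zᵢ} X = Zᵢ X + ⟨Zᵢ, X⟩` of the
    `N_{Zᵢ}` (pub-balaban's `Aop X`, LINEAR in `Zᵢ`) sum EXACTLY to the skew part `Y·perp_Y X` of `N_Y` (`Y = Σcᵢ Zᵢ`);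
  ★ `defect_inner_comm` ∕ `defect_inner_self_nonneg` ∕ `defect_inner_self_le`: `B` is SYMMETRIC, POSITIVE SEMI-DEFINITE (pub-balaban's Jensen step `G_sum_le`)
    and `⟪BX, X⟫ ≤ ψ(θ)‖X‖²` when `‖Zᵢ‖ ≤ θ` (n08-w6's `ψ ≥ 0` and monotonicity `ψ_le_ψ_of_abs_le`);
  ★ `psd_inner_sq_le` ∕ `psd_abs_inner_le` ∕ `psd_norm_le`: [folklore] Cauchy–Schwarz `⟪Bx, y⟫² ≤ ⟪Bx, x⟫⟪By, y⟫` for a symmetric psd `ℝ`-linear map on `Im ℍ`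
    (`discrim_le_zero`), the cross-term bound `|⟪Bx, y⟫| ≤ √⟪Bx,x⟫·√β·‖y‖` and the operator bound `‖Bx‖ ≤ β‖x‖`;
  §1 is the [folklore] toolkit of the projections `par_w`, `perp_w` (linearity, symmetry, Pythagoras, `⟪w·p, q⟫ = ⟪p, w̄·q⟫`).
Parts 30B (`…GuardMonotonePairing`: `⟪m, X⟫ ≥ c₁‖X‖²` for the trivialised tangent) and 30C (`…GuardMonotoneInjective`: the height `t ↦ ⟪k(u e^{tx})·k(u)⁻¹, X⟫`
is increasing, so `k` is INJECTIVE on the guard set for every `Σcᵢ ≤ 1 − 1∕400` at the typed guard `δ₂ = 1∕3` — no sheet count) build on this file.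

HONEST FRAMING.  [folklore] quaternion linear algebra ∕ calculus over pub-balaban's `T4QuatExpLog` ∕ `T4EMLFibreAC` and n08-w6's `ψ` facts BY IMPORT; nothing of
Bałaban's asserted; E6′ NOT decided; the k-uniform `hmass` NOT supplied; count-neutral; N08 NOT discharged; counts unmoved (typed 28∕28 · discharged 5∕27); one
finite 𝕋⁴ programme at fixed ε — R4 closes the CONDITIONAL rung `BalabanLadder.UV` only; the Yang–Mills mass gap (Clay) is NOT proved by any of this; nothing
continuum ∕ OS.  0 `sorry`, 0 `def`, 0 `instance`, 0 `notation`, standard axioms.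
-/

noncomputable section

open NormedSpace Set Metric Function Filter
open scoped RealInnerProductSpace Topology Quaternion

namespace Summit.QuantumFields.YangMills.BalabanUVNodes.N08HaarCompatibilityGuardMonotoneDefect

open Literature.MathematicalPhysics.QuantumFieldTheory.Balaban1983to89
open Literature.MathematicalPhysics.QuantumFieldTheory.Balaban1983to89.T4QuatExpLog
open Literature.MathematicalPhysics.QuantumFieldTheory.Balaban1983to89.T4EMLFibreAC
open Summit.QuantumFields.YangMills.BalabanUVNodes.N08HaarCompatibilityGuardGeodesics
open Summit.QuantumFields.YangMills.BalabanUVNodes.N08HaarCompatibilityGuardJacobianContractionFrame (ψ_nonneg_of_abs_lt_pi ψ_le_ψ_of_abs_le)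

/-! ## §1 The projections `par`, `perp` and the symmetric/skew decomposition of `N` -/

/-- `perp_w` is additive. [folklore] -/
theorem perp_add (w x y : ℍ) : perp w (x + y) = perp w x + perp w y := by
  simp only [perp, par, inner_add_right, add_div, add_smul]
  abel

/-- `perp_w` is homogeneous. [folklore] -/
theorem perp_smul (w : ℍ) (t : ℝ) (x : ℍ) : perp w (t • x) = t • perp w x := by
  simp only [perp, par, real_inner_smul_right, smul_sub, smul_smul, mul_div_assoc]

/-- `⟪par_w x, y⟫ = ⟪w, x⟫⟪w, y⟫ ∕ ‖w‖²`. [folklore] -/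
theorem inner_par_left (w x y : ℍ) : ⟪par w x, y⟫ = ⟪w, x⟫ * ⟪w, y⟫ / ‖w‖ ^ 2 := by
  rw [par, real_inner_smul_left]
  ring

/-- `par_w` is symmetric. [folklore] -/
theorem inner_par_comm (w x y : ℍ) : ⟪par w x, y⟫ = ⟪x, par w y⟫ := by
  rw [inner_par_left, real_inner_comm (par w y) x, inner_par_left]
  ring

/-- `perp_w` is symmetric. [folklore] -/
theorem inner_perp_comm (w x y : ℍ) : ⟪perp w x, y⟫ = ⟪x, perp w y⟫ := by
  rw [perp, perp, inner_sub_left, inner_sub_right, inner_par_comm]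

/-- `⟪par_w x, perp_w x⟫ = 0`. [folklore] -/
theorem inner_par_perp (w x : ℍ) : ⟪par w x, perp w x⟫ = 0 := by
  rw [par, real_inner_smul_left, inner_perp, mul_zero]

/-- `⟪x, par_w x⟫ = ‖par_w x‖²`. [folklore] -/
theorem inner_self_par (w x : ℍ) : ⟪x, par w x⟫ = ‖par w x‖ ^ 2 := by
  nth_rewrite 1 [← par_add_perp w x]
  rw [inner_add_left, real_inner_self_eq_norm_sq, real_inner_comm, inner_par_perp, add_zero]

/-- `⟪x, perp_w x⟫ = ‖perp_w x‖²`. [folklore] -/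
theorem inner_self_perp (w x : ℍ) : ⟪x, perp w x⟫ = ‖perp w x‖ ^ 2 := by
  nth_rewrite 1 [← par_add_perp w x]
  rw [inner_add_left, real_inner_self_eq_norm_sq, inner_par_perp, zero_add]

/-- `⟪perp_w x, x⟫ = ‖perp_w x‖²`. [folklore] -/
theorem inner_perp_self (w x : ℍ) : ⟪perp w x, x⟫ = ‖perp w x‖ ^ 2 := by
  rw [real_inner_comm, inner_self_perp]

/-- Pythagoras: `‖par_w x‖² + ‖perp_w x‖² = ‖x‖²`. [folklore] -/
theorem norm_par_sq_add_norm_perp_sq (w x : ℍ) : ‖par w x‖ ^ 2 + ‖perp w x‖ ^ 2 = ‖x‖ ^ 2 := by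
  rw [← inner_self_par, ← inner_self_perp, ← inner_add_right, par_add_perp, real_inner_self_eq_norm_sq]

/-- `‖perp_w x‖ ≤ ‖x‖`. [folklore] -/
theorem norm_perp_le (w x : ℍ) : ‖perp w x‖ ≤ ‖x‖ := by
  have h := norm_par_sq_add_norm_perp_sq w x
  nlinarith [norm_nonneg (perp w x), norm_nonneg x, sq_nonneg ‖par w x‖]

/-- `‖par_w x‖ ≤ ‖x‖`. [folklore] -/
theorem norm_par_le (w x : ℍ) : ‖par w x‖ ≤ ‖x‖ := by
  have h := norm_par_sq_add_norm_perp_sq w x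
  nlinarith [norm_nonneg (par w x), norm_nonneg x, sq_nonneg ‖perp w x‖]

/-- The real inner product of an imaginary quaternion with a real one vanishes. [folklore] -/
theorem inner_coe_right_of_re {x : ℍ} (hx : x.re = 0) (r : ℝ) : ⟪x, (r : ℍ)⟫ = 0 := by
  rw [Quaternion.inner_def, Quaternion.star_coe, Quaternion.mul_coe_eq_smul, Quaternion.re_smul, hx, smul_zero]

/-- Adjoint of a left multiplication: `⟪w·p, q⟫ = ⟪p, w̄·q⟫`. [folklore] -/
theorem inner_mul_left_eq (w p q : ℍ) : ⟪w * p, q⟫ = ⟪p, star w * q⟫ := by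
  have rmc : ∀ a b : ℍ, (a * b).re = (b * a).re := fun a b => by simp only [Quaternion.re_mul]; ring
  rw [Quaternion.inner_def, Quaternion.inner_def, star_mul, star_star, mul_assoc, rmc, ← mul_assoc]

/-- **THE SYMMETRIC∕SKEW DECOMPOSITION OF `N`**: for imaginary `w`, `N_w x = x − ψ(‖w‖)·perp_w x + A_x w`, `A_x w = w x + ⟨w, x⟩` (pub-balaban's `Aop`,
linear in `w`). [folklore] -/
theorem N_eq_sub_add_Aop {w : ℍ} (hw : w.re = 0) (x : ℍ) : N w x = x - ψ ‖w‖ • perp w x + Aop x w := by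
  have h := par_add_perp w x
  rw [N, ← Aop_eq_mul_perp hw]
  calc par w x + (1 - ψ ‖w‖) • perp w x + Aop x w = (par w x + perp w x) - ψ ‖w‖ • perp w x + Aop x w := by module
    _ = x - ψ ‖w‖ • perp w x + Aop x w := by rw [h]

/-- ★ **`P = (1 − Σcᵢ)·id + B`**: for imaginary `Zᵢ` and `Y = Σᵢ cᵢ Zᵢ`,
`N_Y X − Σᵢ cᵢ N_{Zᵢ} X = (1 − Σcᵢ)·X + (Σᵢ cᵢψ(‖Zᵢ‖)·perp_{Zᵢ} X − ψ(‖Y‖)·perp_Y X)` — the skew parts cancel exactly (`Aop X` is linear). [folklore] -/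
theorem N_sub_sum_N_eq {ι : Type*} [Fintype ι] {Z : ι → ℍ} (hZ : ∀ i, (Z i).re = 0) (c : ι → ℝ) (X : ℍ) :
    N (∑ i, c i • Z i) X - ∑ i, c i • N (Z i) X =
      (1 - ∑ i, c i) • X + (∑ i, (c i * ψ ‖Z i‖) • perp (Z i) X - ψ ‖∑ i, c i • Z i‖ • perp (∑ i, c i • Z i) X) := by
  have hYre : (∑ i, c i • Z i).re = 0 :=
    Finset.sum_induction _ (fun q : ℍ => q.re = 0) (fun p q hp hq => by rw [Quaternion.re_add, hp, hq, add_zero])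
      Quaternion.re_zero (fun i _ => by rw [Quaternion.re_smul, hZ i, smul_zero])
  have hsum : ∑ i, c i • N (Z i) X = (∑ i, c i) • X - ∑ i, (c i * ψ ‖Z i‖) • perp (Z i) X + Aop X (∑ i, c i • Z i) := by
    have h1 : ∀ i, c i • N (Z i) X = c i • X - (c i * ψ ‖Z i‖) • perp (Z i) X + Aop X (c i • Z i) := fun i => by
      rw [N_eq_sub_add_Aop (hZ i), map_smul, smul_add, smul_sub, smul_smul]
    simp_rw [h1, Finset.sum_add_distrib, Finset.sum_sub_distrib, Finset.sum_smul, map_sum]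
  rw [N_eq_sub_add_Aop hYre, hsum]
  module

/-! ## §2 [folklore] Cauchy–Schwarz for a symmetric positive semi-definite `ℝ`-linear map on the imaginary quaternions -/

/-- **CAUCHY–SCHWARZ FOR A SYMMETRIC PSD FORM ON `Im ℍ`**: `⟪Bx, y⟫² ≤ ⟪Bx, x⟫·⟪By, y⟫` for imaginary `x, y` (discriminant of
`t ↦ ⟪B(tx + y), tx + y⟫ ≥ 0`). [folklore] -/
theorem psd_inner_sq_le (B : ℍ →ₗ[ℝ] ℍ) (hsym : ∀ x y : ℍ, x.re = 0 → y.re = 0 → ⟪B x, y⟫ = ⟪x, B y⟫)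
    (hpsd : ∀ x : ℍ, x.re = 0 → 0 ≤ ⟪B x, x⟫) {x y : ℍ} (hx : x.re = 0) (hy : y.re = 0) :
    ⟪B x, y⟫ ^ 2 ≤ ⟪B x, x⟫ * ⟪B y, y⟫ := by
  have hq : ∀ t : ℝ, 0 ≤ ⟪B x, x⟫ * (t * t) + (2 * ⟪B x, y⟫) * t + ⟪B y, y⟫ := by
    intro t
    have hre : (t • x + y).re = 0 := by rw [Quaternion.re_add, Quaternion.re_smul, hx, hy, smul_zero, add_zero]
    have h := hpsd (t • x + y) hre
    have hyx : ⟪B y, x⟫ = ⟪B x, y⟫ := by rw [hsym y x hy hx, real_inner_comm]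
    rw [map_add, map_smul, inner_add_left, inner_add_right, inner_add_right, real_inner_smul_left, real_inner_smul_left,
      real_inner_smul_right, real_inner_smul_right, hyx] at h
    nlinarith [h]
  have hd := discrim_le_zero hq
  rw [discrim] at hd
  nlinarith [hd]

/-- The cross-term bound: `|⟪Bx, y⟫| ≤ √⟪Bx, x⟫ · √β · ‖y‖` when moreover `⟪By, y⟫ ≤ β‖y‖²`. [folklore] -/
theorem psd_abs_inner_le (B : ℍ →ₗ[ℝ] ℍ) (hsym : ∀ x y : ℍ, x.re = 0 → y.re = 0 → ⟪B x, y⟫ = ⟪x, B y⟫)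
    (hpsd : ∀ x : ℍ, x.re = 0 → 0 ≤ ⟪B x, x⟫) {β : ℝ} (hβ : ∀ x : ℍ, x.re = 0 → ⟪B x, x⟫ ≤ β * ‖x‖ ^ 2)
    {x y : ℍ} (hx : x.re = 0) (hy : y.re = 0) :
    |⟪B x, y⟫| ≤ Real.sqrt ⟪B x, x⟫ * (Real.sqrt β * ‖y‖) := by
  have h1 := psd_inner_sq_le B hsym hpsd hx hy
  have h2 : ⟪B x, y⟫ ^ 2 ≤ ⟪B x, x⟫ * (β * ‖y‖ ^ 2) := h1.trans (mul_le_mul_of_nonneg_left (hβ y hy) (hpsd x hx))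
  calc |⟪B x, y⟫| ≤ Real.sqrt (⟪B x, x⟫ * (β * ‖y‖ ^ 2)) := Real.abs_le_sqrt h2
    _ = Real.sqrt ⟪B x, x⟫ * (Real.sqrt β * ‖y‖) := by
        rw [Real.sqrt_mul (hpsd x hx), Real.sqrt_mul' _ (sq_nonneg _), Real.sqrt_sq (norm_nonneg _)]

/-- **OPERATOR NORM FROM THE FORM**: `‖Bx‖ ≤ β‖x‖` for imaginary `x`, when `B` is symmetric psd on `Im ℍ`, maps `Im ℍ` to itself, `⟪Bx,x⟫ ≤ β‖x‖²`
and `0 ≤ β`. [folklore] -/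
theorem psd_norm_le (B : ℍ →ₗ[ℝ] ℍ) (hsym : ∀ x y : ℍ, x.re = 0 → y.re = 0 → ⟪B x, y⟫ = ⟪x, B y⟫)
    (hpsd : ∀ x : ℍ, x.re = 0 → 0 ≤ ⟪B x, x⟫) {β : ℝ} (hβ0 : 0 ≤ β) (hβ : ∀ x : ℍ, x.re = 0 → ⟪B x, x⟫ ≤ β * ‖x‖ ^ 2)
    (him : ∀ x : ℍ, x.re = 0 → (B x).re = 0) {x : ℍ} (hx : x.re = 0) : ‖B x‖ ≤ β * ‖x‖ := by
  have h1 := psd_inner_sq_le B hsym hpsd hx (him x hx)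
  rw [real_inner_self_eq_norm_sq] at h1
  have h2 : (‖B x‖ ^ 2) ^ 2 ≤ (β * ‖x‖ ^ 2) * (β * ‖B x‖ ^ 2) :=
    h1.trans (mul_le_mul (hβ x hx) (hβ (B x) (him x hx)) (hpsd _ (him x hx)) ((hpsd x hx).trans (hβ x hx)))
  rcases eq_or_ne (‖B x‖) 0 with h0 | h0
  · rw [h0]; positivity
  have hBp : 0 < ‖B x‖ ^ 2 := by positivity
  have h3 : ‖B x‖ ^ 2 ≤ β * ‖x‖ ^ 2 * β := le_of_mul_le_mul_right (by nlinarith [h2]) hBp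
  have h4 : ‖B x‖ ^ 2 ≤ (β * ‖x‖) ^ 2 := by nlinarith [h3]
  exact (pow_le_pow_iff_left₀ (norm_nonneg _) (by positivity) two_ne_zero).1 h4


/-! ## §3 The defect operator `B X = Σᵢ cᵢψ(‖Zᵢ‖)·perp_{Zᵢ} X − ψ(‖Y‖)·perp_Y X` of the printed fibre map -/

section Defect

variable {ι : Type*} [Fintype ι]

/-- The defect operator maps imaginary quaternions to imaginary quaternions. [folklore] -/
theorem defect_re {Z : ι → ℍ} (hZ : ∀ i, (Z i).re = 0) (c : ι → ℝ) {Y x : ℍ} (hY : Y.re = 0) (hx : x.re = 0) :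
    (∑ i, (c i * ψ ‖Z i‖) • perp (Z i) x - ψ ‖Y‖ • perp Y x).re = 0 := by
  rw [Quaternion.re_sub, Quaternion.re_smul, perp_re hY hx, smul_zero, sub_zero]
  exact Finset.sum_induction _ (fun q : ℍ => q.re = 0) (fun p q hp hq => by rw [Quaternion.re_add, hp, hq, add_zero])
    Quaternion.re_zero (fun i _ => by rw [Quaternion.re_smul, perp_re (hZ i) hx, smul_zero])

/-- The defect operator is SYMMETRIC. [folklore] -/
theorem defect_inner_comm (Z : ι → ℍ) (c : ι → ℝ) (Y x y : ℍ) :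
    ⟪∑ i, (c i * ψ ‖Z i‖) • perp (Z i) x - ψ ‖Y‖ • perp Y x, y⟫ =
      ⟪x, ∑ i, (c i * ψ ‖Z i‖) • perp (Z i) y - ψ ‖Y‖ • perp Y y⟫ := by
  simp only [inner_sub_left, inner_sub_right, sum_inner, inner_sum, real_inner_smul_left, real_inner_smul_right,
    inner_perp_comm]

/-- The quadratic form of the defect operator: `⟪BX, X⟫ = Σᵢ cᵢ G_{Zᵢ}(X) − G_Y(X)` (pub-balaban's defect form `G`). [folklore] -/
theorem defect_inner_self (Z : ι → ℍ) (c : ι → ℝ) (Y x : ℍ) :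
    ⟪∑ i, (c i * ψ ‖Z i‖) • perp (Z i) x - ψ ‖Y‖ • perp Y x, x⟫ = ∑ i, c i * G (Z i) x - G Y x := by
  simp only [inner_sub_left, sum_inner, real_inner_smul_left, inner_perp_self, G, mul_assoc]

/-- ★ **THE DEFECT OPERATOR IS POSITIVE SEMI-DEFINITE** at `Y = Σᵢ cᵢ Zᵢ` (`Zᵢ ∈ imBall`, `cᵢ ≥ 0`, `Σcᵢ ≤ 1`): pub-balaban's Jensen step
`G_sum_le`. [folklore] -/
theorem defect_inner_self_nonneg {Z : ι → ℍ} {c : ι → ℝ} (hZ : ∀ i, Z i ∈ imBall) (hc : ∀ i, 0 ≤ c i) (hs : ∑ i, c i ≤ 1)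
    (x : ℍ) : 0 ≤ ⟪∑ i, (c i * ψ ‖Z i‖) • perp (Z i) x - ψ ‖∑ i, c i • Z i‖ • perp (∑ i, c i • Z i) x, x⟫ := by
  rw [defect_inner_self]
  linarith [G_sum_le hZ hc hs x]

/-- ★ **THE DEFECT FORM IS BOUNDED BY `ψ(θ)`**: for `cᵢ ≥ 0`, `Σcᵢ ≤ 1`, `‖Zᵢ‖ ≤ θ < π` (`0 ≤ θ`) and `‖Y‖ < π`:
`⟪BX, X⟫ ≤ ψ(θ)‖X‖²` (n08-w6's `ψ ≥ 0` and monotonicity of `ψ`, `‖perp X‖ ≤ ‖X‖`). [folklore] -/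
theorem defect_inner_self_le {Z : ι → ℍ} {c : ι → ℝ} (hc : ∀ i, 0 ≤ c i) (hs : ∑ i, c i ≤ 1) {θ : ℝ} (hθ0 : 0 ≤ θ)
    (hθπ : θ < Real.pi) (hZθ : ∀ i, ‖Z i‖ ≤ θ) {Y : ℍ} (hYπ : ‖Y‖ < Real.pi) (x : ℍ) :
    ⟪∑ i, (c i * ψ ‖Z i‖) • perp (Z i) x - ψ ‖Y‖ • perp Y x, x⟫ ≤ ψ θ * ‖x‖ ^ 2 := by
  rw [defect_inner_self]
  have hψY : 0 ≤ ψ ‖Y‖ := ψ_nonneg_of_abs_lt_pi (by rwa [abs_norm])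
  have hψθ : 0 ≤ ψ θ := ψ_nonneg_of_abs_lt_pi (by rwa [abs_of_nonneg hθ0])
  have hGY : 0 ≤ G Y x := mul_nonneg hψY (sq_nonneg _)
  have hGi : ∀ i, c i * G (Z i) x ≤ c i * (ψ θ * ‖x‖ ^ 2) := fun i =>
    mul_le_mul_of_nonneg_left
      (mul_le_mul (ψ_le_ψ_of_abs_le (by rw [abs_norm]; exact hZθ i) hθπ)
        (pow_le_pow_left₀ (norm_nonneg _) (norm_perp_le (Z i) x) 2) (sq_nonneg _) hψθ) (hc i)
  calc ∑ i, c i * G (Z i) x - G Y x ≤ ∑ i, c i * G (Z i) x := by linarith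
    _ ≤ ∑ i, c i * (ψ θ * ‖x‖ ^ 2) := Finset.sum_le_sum fun i _ => hGi i
    _ = (∑ i, c i) * (ψ θ * ‖x‖ ^ 2) := by rw [Finset.sum_mul]
    _ ≤ 1 * (ψ θ * ‖x‖ ^ 2) := mul_le_mul_of_nonneg_right hs (by positivity)
    _ = ψ θ * ‖x‖ ^ 2 := one_mul _

end Defect

end Summit.QuantumFields.YangMills.BalabanUVNodes.N08HaarCompatibilityGuardMonotoneDefect

end
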